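import Mathlib
import Summits.NavierStokesRegularity.NavierStokesRegularity.Theorems.EulerZoomLiouvillePowerGaugeEulerLiouvilleMirrorMomentWeights
import Literature.Analysis.Calculus.SmoothCutoff
import Summits.NavierStokesRegularity.NavierStokesRegularity.Theorems.EulerZoomLiouvillePowerGaugeEulerLiouvilleSwirlfreeLedgerConfinement
import HarnessLib

/-!
# Crux `EulerZoomLiouville.PowerGaugeEulerLiouville` (stmt-NavierStokesRegularity-19832), line `mirror-moment`, stub M1 — time side, part 3b:
# THE MOVING SIGN-ADAPTED WEIGHT `Z = Ψ((⟨x⟩+Bσ)/R) · (⟨x⟩+B(T−σ)) · s_δ(x₃)` IS A SUPERSOLUTION OF THE TRANSPORT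

Route №10 `EulerZoomLiouville` (NavierStokesRegularity), crux E, line `mirror-moment`, stub `stub_momentMonotone` (M1).  Seat ns-sfl-p1 g3.
To bound the weighted ledger moment `∫ (1+‖x‖) |Ω(σ)|` UNIFORMLY on a time slab from its value at the initial slice (part 3c), the transport
`∂ₜΩ = −DΩ[v]` (`|v| ≤ B`) is tested against the explicit weight family (written out, no definition)
`Z(σ,x) = Ψ_R(σ,x) · m(σ,x) · s_δ(x₃)`, `Ψ_R = smoothTransition (2 − (⟨x⟩ + Bσ)/R)` (a ball SHRINKING at speed `B`),
`m = ⟨x⟩ + B(T−σ)` (a weight DECREASING at speed `B`, `|∇⟨x⟩| ≤ 1`), `s_δ(z) = smoothTransition(z/δ) − smoothTransition(−z/δ)` (a smooth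
sign, so that `s_δ(x₃) Ω ≥ 0` under the outgoing sign).  This file proves the calculus of `Z`:

* `contDiff_weightZ`, `weightZ_eq_zero_of_lt_norm` — smooth in `(σ, x)`; vanishes for `‖x‖ > 2R` (`σ ≥ 0`);
* `weightZ_supersolution` — **`ω (∂ₜZ + DZ[w]) ≤ B · Ψ_R m s_δ'(x₃) · |ω|`** whenever `‖w‖ ≤ B` and `ω s_δ(x₃) ≥ 0`:
  the transport part is `≤ 0` (`Ψ' ≥ 0` is hit by `−(B + D⟨·⟩[w])/R ≤ 0`, `m` by `−B + D⟨·⟩[w] ≤ 0`), only the sign layer `|x₃| < δ` pays;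
* `oddSwitch_eq_one/_eq_neg_one`, `abs_oddSwitch_le_one`, `mul_oddSwitch_nonneg`, `oddSwitch_deriv_bounds` — the smooth sign `s_δ` and its
  layer derivative (`= ±1` off the layer, `|s_δ| ≤ 1`, sign of `z`, `0 ≤ s_δ' ≤ 2D/δ`, `s_δ' = 0` off `|z| < δ`); `profile_bounds` —
  `0 ≤ Ψ_R m ≤ 2R + BT` on `0 ≤ σ ≤ T`, plateau `= 0` for `‖x‖ > 2R`;
* `weightZ_source_le_indicator` — with `|ω| ≤ L|x₃|` on `‖x‖ ≤ 2R` (the plane vanishing of `Ω`, ns-ezl-w2's `…MirrorMomentPlaneVanishing`):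
  **`ω (∂ₜZ + DZ[w]) ≤ 2B(2R+BT)DL · 1_{‖x‖≤2R, |x₃|≤δ}`** — the source is a bounded function of the layer box, whose volume is `O(δ)`.
(Here `x₃` denotes the coordinate `x 2`.)

WHAT THIS IS NOT: not NS, not the crux E — helper `--supports` stmt-19832 (calculus for ONE stratum lemma); 19832 OPEN.  [folklore]
-/

noncomputable section

-- flat `Theorems/<Route><Decl>…` files of one crux share the namespace of the crux (tree convention)
set_option linter.dupNamespace false

open MeasureTheory Set Filter Topology Metric Function
open scoped NNReal ENNReal RealInnerProductSpace

namespace Summit.NavierStokesRegularity.NavierStokesRegularity.Theorems.PowerGaugeEulerLiouville.MirrorMoment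

open Literature.Analysis Literature.Analysis.FluidPDE

/-! ### Smoothness and support -/

/-- The weight family `Z` is jointly smooth in `(σ, x)`. [folklore] -/
theorem contDiff_weightZ (B T R δ : ℝ) :
    ContDiff ℝ (⊤ : ℕ∞) (uncurry fun (σ : ℝ) (x : EuclideanSpace ℝ (Fin 3)) => (Real.smoothTransition (2 - (Real.sqrt (1 + ‖x‖ ^ 2) + B * σ) / R) * (Real.sqrt (1 + ‖x‖ ^ 2) + B * (T - σ)) * (Real.smoothTransition (x 2 / δ) - Real.smoothTransition (-(x 2) / δ)))) := by
  have hbrk : ContDiff ℝ (⊤ : ℕ∞) fun q : ℝ × EuclideanSpace ℝ (Fin 3) => Real.sqrt (1 + ‖q.2‖ ^ 2) :=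
    contDiff_bracket.comp contDiff_snd
  have hσ : ContDiff ℝ (⊤ : ℕ∞) fun q : ℝ × EuclideanSpace ℝ (Fin 3) => q.1 := contDiff_fst
  have h2 : ContDiff ℝ (⊤ : ℕ∞) fun q : ℝ × EuclideanSpace ℝ (Fin 3) => q.2 2 :=
    (EuclideanSpace.proj (𝕜 := ℝ) (2 : Fin 3)).contDiff.comp contDiff_snd
  have hsT : ContDiff ℝ (⊤ : ℕ∞) Real.smoothTransition := Real.smoothTransition.contDiff
  have e : (uncurry fun (σ : ℝ) (x : EuclideanSpace ℝ (Fin 3)) => (Real.smoothTransition (2 - (Real.sqrt (1 + ‖x‖ ^ 2) + B * σ) / R) * (Real.sqrt (1 + ‖x‖ ^ 2) + B * (T - σ)) * (Real.smoothTransition (x 2 / δ) - Real.smoothTransition (-(x 2) / δ)))) = fun q : ℝ × EuclideanSpace ℝ (Fin 3) =>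
      Real.smoothTransition (2 - (Real.sqrt (1 + ‖q.2‖ ^ 2) + B * q.1) / R) * (Real.sqrt (1 + ‖q.2‖ ^ 2) + B * (T - q.1)) *
        (Real.smoothTransition (q.2 2 / δ) - Real.smoothTransition (-(q.2 2) / δ)) := by
    funext q; rfl
  rw [e]
  refine ((hsT.comp ?_).mul ?_).mul ((hsT.comp (h2.div_const δ)).sub (hsT.comp (h2.neg.div_const δ)))
  · exact contDiff_const.sub ((hbrk.add (contDiff_const.mul hσ)).div_const R)
  · exact hbrk.add (contDiff_const.mul (contDiff_const.sub hσ))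

/-- The slices of `Z` are supported in the closed ball of radius `2R` (for `B, σ ≥ 0`, `R > 0`): outside it `⟨x⟩ + Bσ > 2R`, so the
shrinking plateau vanishes. [folklore] -/
theorem weightZ_eq_zero_of_lt_norm {B T R δ σ : ℝ} (hB : 0 ≤ B) (hσ : 0 ≤ σ) (hR : 0 < R) {x : EuclideanSpace ℝ (Fin 3)}
    (hx : x ∉ closedBall (0 : EuclideanSpace ℝ (Fin 3)) (2 * R)) : (Real.smoothTransition (2 - (Real.sqrt (1 + ‖x‖ ^ 2) + B * σ) / R) * (Real.sqrt (1 + ‖x‖ ^ 2) + B * (T - σ)) * (Real.smoothTransition (x 2 / δ) - Real.smoothTransition (-(x 2) / δ))) = 0 := by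
  rw [mem_closedBall_zero_iff, not_le] at hx
  obtain ⟨-, hle, -⟩ := bracket_bounds x
  have h : Real.smoothTransition (2 - (Real.sqrt (1 + ‖x‖ ^ 2) + B * σ) / R) = 0 := by
    apply Real.smoothTransition.zero_of_nonpos
    rw [sub_nonpos, le_div_iff₀ hR]
    nlinarith [mul_nonneg hB hσ]
  rw [h, zero_mul, zero_mul]

/-! ### The transport derivative of `Z` along a vector `w` -/

/-- **The transport operator on `Z`, as a one-variable derivative, and the SUPERSOLUTION INEQUALITY.**  For `σ ≤ T`, `0 ≤ B`, `0 < R`,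
`0 < δ`, a point `x` and a vector `w` with `‖w‖ ≤ B`:  `(∂ₜZ)(σ,x) + DZ(σ,·)(x)[w]` — computed as the derivative at `r = σ` of
`r ↦ Z(r, x + (r−σ) w)` — satisfies, for every real `ω` with `ω · s_δ(x₃) ≥ 0`,
`ω · (∂ₜZ + DZ[w]) ≤ B · Ψ_R m · s_δ'(x₃) · |ω|`, `s_δ'(z) = (sT'(z/δ) + sT'(−z/δ))/δ ≥ 0`:
the plateau and the weight are hit with non-positive coefficients (`|D⟨·⟩[w]| ≤ ‖w‖ ≤ B`, `sT' ≥ 0`), only the sign layer pays. [folklore] -/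
theorem weightZ_supersolution {B T R δ σ : ℝ} (hB : 0 ≤ B) (hσT : σ ≤ T) (hR : 0 < R) (hδ : 0 < δ)
    (x w : EuclideanSpace ℝ (Fin 3)) (hw : ‖w‖ ≤ B) {ω : ℝ}
    (hω : 0 ≤ ω * (Real.smoothTransition (x 2 / δ) - Real.smoothTransition (-(x 2) / δ))) :
    ω * (deriv (fun r : ℝ => (Real.smoothTransition (2 - (Real.sqrt (1 + ‖x‖ ^ 2) + B * r) / R) * (Real.sqrt (1 + ‖x‖ ^ 2) + B * (T - r)) * (Real.smoothTransition (x 2 / δ) - Real.smoothTransition (-(x 2) / δ)))) σ + fderiv ℝ (fun y : EuclideanSpace ℝ (Fin 3) => (Real.smoothTransition (2 - (Real.sqrt (1 + ‖y‖ ^ 2) + B * σ) / R) * (Real.sqrt (1 + ‖y‖ ^ 2) + B * (T - σ)) * (Real.smoothTransition (y 2 / δ) - Real.smoothTransition (-(y 2) / δ)))) x w) ≤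
      B * (Real.smoothTransition (2 - (Real.sqrt (1 + ‖x‖ ^ 2) + B * σ) / R) * (Real.sqrt (1 + ‖x‖ ^ 2) + B * (T - σ)) *
        ((deriv Real.smoothTransition (x 2 / δ) + deriv Real.smoothTransition (-(x 2) / δ)) / δ)) * |ω| := by
  obtain ⟨hb1, -, -⟩ := bracket_bounds x
  have hsT : ∀ t : ℝ, HasDerivAt Real.smoothTransition (deriv Real.smoothTransition t) t := fun t =>
    ((Real.smoothTransition.contDiff (n := 1)).differentiable one_ne_zero t).hasDerivAt
  have hsT' : ∀ t : ℝ, 0 ≤ deriv Real.smoothTransition t := fun t => Real.smoothTransition.monotone.deriv_nonneg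
  -- the line `γ r = x + (r − σ) • w` and the bracket along it
  set γ : ℝ → EuclideanSpace ℝ (Fin 3) := fun r => x + (r - σ) • w with hγ
  have hγσ : γ σ = x := by simp [hγ]
  have hγd : HasDerivAt γ w σ := by
    have h := ((hasDerivAt_id σ).sub_const σ).smul_const w |>.const_add x
    simpa [hγ] using h
  have hcB : |fderiv ℝ (fun y : EuclideanSpace ℝ (Fin 3) => Real.sqrt (1 + ‖y‖ ^ 2)) x w| ≤ B := (abs_fderiv_bracket_le x w).trans hw
  have hbr : HasDerivAt (fun r : ℝ => Real.sqrt (1 + ‖γ r‖ ^ 2))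
      (fderiv ℝ (fun y : EuclideanSpace ℝ (Fin 3) => Real.sqrt (1 + ‖y‖ ^ 2)) x w) σ := by
    have h := (hasFDerivAt_bracket x).comp_hasDerivAt_of_eq σ hγd hγσ.symm
    rw [(hasFDerivAt_bracket x).fderiv]
    exact h
  -- the three factors along the line
  have hA : HasDerivAt (fun r : ℝ => Real.smoothTransition (2 - (Real.sqrt (1 + ‖γ r‖ ^ 2) + B * r) / R))
      (deriv Real.smoothTransition (2 - (Real.sqrt (1 + ‖γ σ‖ ^ 2) + B * σ) / R) *
        (-(fderiv ℝ (fun y : EuclideanSpace ℝ (Fin 3) => Real.sqrt (1 + ‖y‖ ^ 2)) x w + B) / R)) σ := by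
    have h1 : HasDerivAt (fun r : ℝ => 2 - (Real.sqrt (1 + ‖γ r‖ ^ 2) + B * r) / R)
        (-(fderiv ℝ (fun y : EuclideanSpace ℝ (Fin 3) => Real.sqrt (1 + ‖y‖ ^ 2)) x w + B) / R) σ := by
      have h := ((hbr.add ((hasDerivAt_id σ).const_mul B)).div_const R).const_sub 2
      exact h.congr_deriv (by ring)
    exact (hsT _).comp σ h1
  have hM : HasDerivAt (fun r : ℝ => Real.sqrt (1 + ‖γ r‖ ^ 2) + B * (T - r))
      (fderiv ℝ (fun y : EuclideanSpace ℝ (Fin 3) => Real.sqrt (1 + ‖y‖ ^ 2)) x w - B) σ := by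
    have h := hbr.add (((hasDerivAt_id σ).const_sub T).const_mul B)
    exact h.congr_deriv (by ring)
  have hS : HasDerivAt (fun r : ℝ => Real.smoothTransition ((γ r) 2 / δ) - Real.smoothTransition (-((γ r) 2) / δ))
      ((deriv Real.smoothTransition (x 2 / δ) + deriv Real.smoothTransition (-(x 2) / δ)) / δ * w 2) σ := by
    have hγ2 : HasDerivAt (fun r : ℝ => (γ r) 2) (w 2) σ := by
      have e : (fun r : ℝ => (γ r) 2) = fun r => x 2 + (r - σ) * w 2 := by
        funext r; simp [hγ]
      rw [e]
      have h := (((hasDerivAt_id σ).sub_const σ).mul_const (w 2)).const_add (x 2)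
      exact h.congr_deriv (by simp)
    have hp : HasDerivAt (fun r : ℝ => (γ r) 2 / δ) (w 2 / δ) σ := hγ2.div_const δ
    have hn : HasDerivAt (fun r : ℝ => -((γ r) 2) / δ) (-(w 2) / δ) σ := hγ2.neg.div_const δ
    have h1 := (hsT _).comp σ hp
    have h2 := (hsT _).comp σ hn
    have e1 : (γ σ) 2 / δ = x 2 / δ := by rw [hγσ]
    have e2 : -((γ σ) 2) / δ = -(x 2) / δ := by rw [hγσ]
    rw [e1] at h1
    rw [e2] at h2
    exact (h1.sub h2).congr_deriv (by field_simp; ring)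
  -- the product and its derivative at `σ`, identified with `∂ₜZ + DZ[w]` by the two-variable chain rule
  have hprod := (hA.mul hM).mul hS
  simp only [Pi.mul_apply] at hprod
  rw [hγσ] at hprod
  have hdiff : DifferentiableAt ℝ (uncurry fun (r : ℝ) (y : EuclideanSpace ℝ (Fin 3)) => (Real.smoothTransition (2 - (Real.sqrt (1 + ‖y‖ ^ 2) + B * r) / R) * (Real.sqrt (1 + ‖y‖ ^ 2) + B * (T - r)) * (Real.smoothTransition (y 2 / δ) - Real.smoothTransition (-(y 2) / δ)))) (σ, γ σ) :=
    ((contDiff_weightZ B T R δ).differentiable (by simp)).differentiableAt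
  have hchain := Summit.NavierStokesRegularity.NavierStokesRegularity.Theorems.PowerGaugeEulerLiouville.SwirlfreeLedger.hasDerivAt_uncurry_comp
    (f := fun (r : ℝ) (y : EuclideanSpace ℝ (Fin 3)) => (Real.smoothTransition (2 - (Real.sqrt (1 + ‖y‖ ^ 2) + B * r) / R) * (Real.sqrt (1 + ‖y‖ ^ 2) + B * (T - r)) * (Real.smoothTransition (y 2 / δ) - Real.smoothTransition (-(y 2) / δ)))) hdiff hγd
  rw [hγσ] at hchain
  have hval := hprod.unique hchain
  rw [← hval]
  -- abbreviations and signs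
  set c : ℝ := fderiv ℝ (fun y : EuclideanSpace ℝ (Fin 3) => Real.sqrt (1 + ‖y‖ ^ 2)) x w with hc
  set b : ℝ := Real.sqrt (1 + ‖x‖ ^ 2) with hb
  set Ψ : ℝ := Real.smoothTransition (2 - (b + B * σ) / R) with hΨ
  set Ψ' : ℝ := deriv Real.smoothTransition (2 - (b + B * σ) / R) with hΨ'
  set m : ℝ := b + B * (T - σ) with hm
  set s₀ : ℝ := Real.smoothTransition (x 2 / δ) - Real.smoothTransition (-(x 2) / δ) with hs₀
  set s₁ : ℝ := (deriv Real.smoothTransition (x 2 / δ) + deriv Real.smoothTransition (-(x 2) / δ)) / δ with hs₁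
  have hΨ0 : 0 ≤ Ψ := Real.smoothTransition.nonneg _
  have hΨ'0 : 0 ≤ Ψ' := hsT' _
  have hm0 : 0 ≤ m := by rw [hm]; nlinarith
  have hs₁0 : 0 ≤ s₁ := by rw [hs₁]; exact div_nonneg (add_nonneg (hsT' _) (hsT' _)) hδ.le
  have hcB' := abs_le.1 hcB
  have hw2 : |w 2| ≤ B := by
    have h := PiLp.norm_apply_le w 2
    rw [Real.norm_eq_abs] at h
    exact h.trans hw
  have hw2' := abs_le.1 hw2
  -- the transport part is `≤ 0`
  have hbracket : Ψ' * (-(c + B) / R) * m + Ψ * (c - B) ≤ 0 := by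
    have h1 : 0 ≤ Ψ' * ((c + B) / R) * m := mul_nonneg (mul_nonneg hΨ'0 (div_nonneg (by linarith) hR.le)) hm0
    have e : Ψ' * (-(c + B) / R) * m = -(Ψ' * ((c + B) / R) * m) := by ring
    have h2 : Ψ * (c - B) ≤ 0 := mul_nonpos_of_nonneg_of_nonpos hΨ0 (by linarith)
    linarith
  have e : ω * ((Ψ' * (-(c + B) / R) * m + Ψ * (c - B)) * s₀ + Ψ * m * (s₁ * w 2)) =
      (ω * s₀) * (Ψ' * (-(c + B) / R) * m + Ψ * (c - B)) + (Ψ * m * s₁) * (ω * w 2) := by ring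
  rw [e]
  have h1 : (ω * s₀) * (Ψ' * (-(c + B) / R) * m + Ψ * (c - B)) ≤ 0 := mul_nonpos_of_nonneg_of_nonpos hω hbracket
  have h2 : (Ψ * m * s₁) * (ω * w 2) ≤ B * (Ψ * m * s₁) * |ω| := by
    have hk : 0 ≤ Ψ * m * s₁ := by positivity
    have h3 : ω * w 2 ≤ |ω| * B := by
      calc ω * w 2 ≤ |ω * w 2| := le_abs_self _
        _ = |ω| * |w 2| := abs_mul _ _
        _ ≤ |ω| * B := by gcongr
    calc (Ψ * m * s₁) * (ω * w 2) ≤ (Ψ * m * s₁) * (|ω| * B) := by gcongr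
      _ = B * (Ψ * m * s₁) * |ω| := by ring
  linarith

/-! ### The smooth odd switch `s_δ(z) = sT(z/δ) − sT(−z/δ)` and its layer derivative -/

/-- `s_δ(z) = 1` for `z ≥ δ`. [folklore] -/
theorem oddSwitch_eq_one {δ z : ℝ} (hδ : 0 < δ) (hz : δ ≤ z) :
    Real.smoothTransition (z / δ) - Real.smoothTransition (-z / δ) = 1 := by
  rw [Real.smoothTransition.one_of_one_le ((one_le_div hδ).2 hz),
    Real.smoothTransition.zero_of_nonpos (div_nonpos_of_nonpos_of_nonneg (by linarith) hδ.le), sub_zero]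

/-- `s_δ(z) = −1` for `z ≤ −δ`. [folklore] -/
theorem oddSwitch_eq_neg_one {δ z : ℝ} (hδ : 0 < δ) (hz : z ≤ -δ) :
    Real.smoothTransition (z / δ) - Real.smoothTransition (-z / δ) = -1 := by
  rw [Real.smoothTransition.zero_of_nonpos (div_nonpos_of_nonpos_of_nonneg (by linarith) hδ.le),
    Real.smoothTransition.one_of_one_le ((one_le_div hδ).2 (by linarith)), zero_sub]

/-- `|s_δ(z)| ≤ 1`. [folklore] -/
theorem abs_oddSwitch_le_one (δ z : ℝ) : |Real.smoothTransition (z / δ) - Real.smoothTransition (-z / δ)| ≤ 1 := by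
  rw [abs_le]
  constructor
  · linarith [Real.smoothTransition.nonneg (z / δ), Real.smoothTransition.le_one (-z / δ)]
  · linarith [Real.smoothTransition.nonneg (-z / δ), Real.smoothTransition.le_one (z / δ)]

/-- `s_δ` has the sign of `z`: `ω s_δ(z) ≥ 0` whenever `z ω ≥ 0` (`δ > 0`). [folklore] -/
theorem mul_oddSwitch_nonneg {δ z ω : ℝ} (hδ : 0 < δ) (h : 0 ≤ z * ω) :
    0 ≤ ω * (Real.smoothTransition (z / δ) - Real.smoothTransition (-z / δ)) := by
  have hmono := Real.smoothTransition.monotone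
  rcases lt_trichotomy z 0 with hz | hz | hz
  · have hω : ω ≤ 0 := by
      by_contra hω'
      rw [not_le] at hω'
      nlinarith
    have hs : Real.smoothTransition (z / δ) - Real.smoothTransition (-z / δ) ≤ 0 :=
      sub_nonpos.2 (hmono (by rw [div_le_div_iff_of_pos_right hδ]; linarith))
    exact mul_nonneg_of_nonpos_of_nonpos hω hs
  · rw [hz, neg_zero, sub_self, mul_zero]
  · have hω : 0 ≤ ω := by
      by_contra hω'
      rw [not_le] at hω'
      nlinarith
    have hs : 0 ≤ Real.smoothTransition (z / δ) - Real.smoothTransition (-z / δ) :=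
      sub_nonneg.2 (hmono (by rw [div_le_div_iff_of_pos_right hδ]; linarith))
    exact mul_nonneg hω hs

/-- The layer derivative `s_δ'(z) = (sT'(z/δ) + sT'(−z/δ))/δ` is `≥ 0`, `≤ 2D/δ` for any bound `|sT'| ≤ D`, and VANISHES OFF THE LAYER
`|z| < δ`. [folklore] -/
theorem oddSwitch_deriv_bounds {δ : ℝ} (hδ : 0 < δ) {D : ℝ} (hD : ∀ t : ℝ, |deriv Real.smoothTransition t| ≤ D) (z : ℝ) :
    0 ≤ (deriv Real.smoothTransition (z / δ) + deriv Real.smoothTransition (-z / δ)) / δ ∧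
      (deriv Real.smoothTransition (z / δ) + deriv Real.smoothTransition (-z / δ)) / δ ≤ 2 * D / δ ∧
      (δ ≤ |z| → (deriv Real.smoothTransition (z / δ) + deriv Real.smoothTransition (-z / δ)) / δ = 0) := by
  have h0 : ∀ t : ℝ, 0 ≤ deriv Real.smoothTransition t := fun t => Real.smoothTransition.monotone.deriv_nonneg
  refine ⟨div_nonneg (add_nonneg (h0 _) (h0 _)) hδ.le, ?_, fun hz => ?_⟩
  · rw [div_le_div_iff_of_pos_right hδ]
    linarith [(abs_le.1 (hD (z / δ))).2, (abs_le.1 (hD (-z / δ))).2]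
  · rcases le_abs'.1 hz with hz | hz
    · rw [Literature.Analysis.Calculus.deriv_smoothTransition_of_nonpos (div_nonpos_of_nonpos_of_nonneg (by linarith) hδ.le),
        Literature.Analysis.Calculus.deriv_smoothTransition_of_one_le ((one_le_div hδ).2 (by linarith)), zero_add, zero_div]
    · rw [Literature.Analysis.Calculus.deriv_smoothTransition_of_one_le ((one_le_div hδ).2 hz),
        Literature.Analysis.Calculus.deriv_smoothTransition_of_nonpos (div_nonpos_of_nonpos_of_nonneg (by linarith) hδ.le),
        zero_add, zero_div]

/-! ### The profile `Ψ_R · m` -/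

/-- On the slab `0 ≤ σ ≤ T` the profile `Ψ_R(σ,x) · m(σ,x)` is `≥ 0` and `≤ 2R + BT`, and the plateau `Ψ_R(σ,x)` vanishes for
`‖x‖ > 2R`. [folklore] -/
theorem profile_bounds {B T R σ : ℝ} (hB : 0 ≤ B) (hσ : 0 ≤ σ) (hσT : σ ≤ T) (hR : 0 < R) (x : EuclideanSpace ℝ (Fin 3)) :
    0 ≤ Real.smoothTransition (2 - (Real.sqrt (1 + ‖x‖ ^ 2) + B * σ) / R) * (Real.sqrt (1 + ‖x‖ ^ 2) + B * (T - σ)) ∧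
      Real.smoothTransition (2 - (Real.sqrt (1 + ‖x‖ ^ 2) + B * σ) / R) * (Real.sqrt (1 + ‖x‖ ^ 2) + B * (T - σ)) ≤ 2 * R + B * T ∧
      (2 * R < ‖x‖ → Real.smoothTransition (2 - (Real.sqrt (1 + ‖x‖ ^ 2) + B * σ) / R) = 0) := by
  obtain ⟨hb1, hle, -⟩ := bracket_bounds x
  have hm0 : 0 ≤ Real.sqrt (1 + ‖x‖ ^ 2) + B * (T - σ) := by nlinarith
  have hΨ0 := Real.smoothTransition.nonneg (2 - (Real.sqrt (1 + ‖x‖ ^ 2) + B * σ) / R)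
  have hΨ1 := Real.smoothTransition.le_one (2 - (Real.sqrt (1 + ‖x‖ ^ 2) + B * σ) / R)
  have hzero : 2 * R ≤ Real.sqrt (1 + ‖x‖ ^ 2) → Real.smoothTransition (2 - (Real.sqrt (1 + ‖x‖ ^ 2) + B * σ) / R) = 0 := by
    intro h
    apply Real.smoothTransition.zero_of_nonpos
    rw [sub_nonpos, le_div_iff₀ hR]
    nlinarith [mul_nonneg hB hσ]
  refine ⟨mul_nonneg hΨ0 hm0, ?_, fun h => hzero (h.le.trans hle)⟩
  have hT : 0 ≤ T := hσ.trans hσT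
  by_cases hb : 2 * R ≤ Real.sqrt (1 + ‖x‖ ^ 2)
  · rw [hzero hb, zero_mul]; positivity
  · rw [not_le] at hb
    calc Real.smoothTransition (2 - (Real.sqrt (1 + ‖x‖ ^ 2) + B * σ) / R) * (Real.sqrt (1 + ‖x‖ ^ 2) + B * (T - σ))
        ≤ 1 * (Real.sqrt (1 + ‖x‖ ^ 2) + B * (T - σ)) := by gcongr
      _ ≤ 2 * R + B * T := by nlinarith [mul_nonneg hB hσ]

/-! ### Domination of the source by a constant on the layer box -/

/-- **The source is dominated by a constant on the layer box.**  On the slab `0 ≤ σ ≤ T`, with `|sT'| ≤ D` and a point–value pair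
`(x, ω)` such that `ω s_δ(x 2) ≥ 0` and `|ω| ≤ L |x 2|` whenever `‖x‖ ≤ 2R`:
`ω (∂ₜZ + DZ[w]) ≤ 2B(2R+BT)·D·L · 1_{‖x‖ ≤ 2R, |x 2| ≤ δ}(x)` — the factor `1/δ` of `s_δ'` is paid by `|ω| ≤ L|x 2| ≤ Lδ` on the layer,
and off the box either the plateau or `s_δ'` vanishes. [folklore] -/
theorem weightZ_source_le_indicator {B T R δ σ : ℝ} (hB : 0 ≤ B) (hσ : 0 ≤ σ) (hσT : σ ≤ T) (hR : 0 < R) (hδ : 0 < δ)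
    {D : ℝ} (hD : ∀ t : ℝ, |deriv Real.smoothTransition t| ≤ D) {L : ℝ} (hL0 : 0 ≤ L)
    (x w : EuclideanSpace ℝ (Fin 3)) (hw : ‖w‖ ≤ B) {ω : ℝ}
    (hω : 0 ≤ ω * (Real.smoothTransition (x 2 / δ) - Real.smoothTransition (-(x 2) / δ)))
    (hL : ‖x‖ ≤ 2 * R → |ω| ≤ L * |x 2|) :
    ω * (deriv (fun r : ℝ => (Real.smoothTransition (2 - (Real.sqrt (1 + ‖x‖ ^ 2) + B * r) / R) * (Real.sqrt (1 + ‖x‖ ^ 2) + B * (T - r)) * (Real.smoothTransition (x 2 / δ) - Real.smoothTransition (-(x 2) / δ)))) σ + fderiv ℝ (fun y : EuclideanSpace ℝ (Fin 3) => (Real.smoothTransition (2 - (Real.sqrt (1 + ‖y‖ ^ 2) + B * σ) / R) * (Real.sqrt (1 + ‖y‖ ^ 2) + B * (T - σ)) * (Real.smoothTransition (y 2 / δ) - Real.smoothTransition (-(y 2) / δ)))) x w) ≤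
      Set.indicator (closedBall (0 : EuclideanSpace ℝ (Fin 3)) (2 * R) ∩ {y | |y 2| ≤ δ}) (fun _ => 2 * B * (2 * R + B * T) * D * L) x := by
  have hD0 : 0 ≤ D := (abs_nonneg _).trans (hD 0)
  refine (weightZ_supersolution hB hσT hR hδ x w hw hω).trans ?_
  obtain ⟨hP0, hP1, hΨ0⟩ := profile_bounds (T := T) hB hσ hσT hR x
  have hs := oddSwitch_deriv_bounds hδ hD (x 2)
  rw [neg_div] at hs ⊢
  obtain ⟨hs0, hs1, hs2⟩ := hs
  by_cases hx : x ∈ closedBall (0 : EuclideanSpace ℝ (Fin 3)) (2 * R) ∩ {y | |y 2| ≤ δ}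
  · rw [Set.indicator_of_mem hx]
    have hx1 : ‖x‖ ≤ 2 * R := mem_closedBall_zero_iff.1 hx.1
    have hx2 : |x 2| ≤ δ := hx.2
    have hωδ : |ω| ≤ L * δ := (hL hx1).trans (by gcongr)
    calc B * (Real.smoothTransition (2 - (Real.sqrt (1 + ‖x‖ ^ 2) + B * σ) / R) * (Real.sqrt (1 + ‖x‖ ^ 2) + B * (T - σ)) *
          ((deriv Real.smoothTransition (x 2 / δ) + deriv Real.smoothTransition (-(x 2 / δ))) / δ)) * |ω|
        ≤ B * ((2 * R + B * T) * (2 * D / δ)) * (L * δ) := by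
          have hT : 0 ≤ T := hσ.trans hσT
          gcongr
      _ = 2 * B * (2 * R + B * T) * D * L := by field_simp
  · rw [Set.indicator_of_notMem hx]
    rw [mem_inter_iff, not_and_or, mem_closedBall_zero_iff, not_le, mem_setOf_eq, not_le] at hx
    rcases hx with hx | hx
    · rw [hΨ0 hx, zero_mul, zero_mul, mul_zero, zero_mul]
    · rw [hs2 hx.le, mul_zero, mul_zero, zero_mul]

end Summit.NavierStokesRegularity.NavierStokesRegularity.Theorems.PowerGaugeEulerLiouville.MirrorMoment

end
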